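import Literature.Analysis.FluidPDE.FluidComputer.ClassicalLatticeData
import HarnessLib

/-!
# The Arnold–Beltrami–Childress datum of the FLUID COMPUTER cell (`CL-abc`): closed form, divergence-free, Beltrami with eigenvalue one, Bernoulli form of the advection term, and the exact `e^{-νt}` Navier–Stokes decay (pointwise)

HONEST FRAMING (cell `pub-fluidc`, verbatim): *low prior, high value-of-information experiment on
Tao's machine paradigm; NOT a claim that NS blows up.* Companion to `ClassicalLatticeData`
(Taylor–Green, Kida–Pelz). Apart from the POINTWISE verification of the classical decaying
solution in its last section, this file contains no statement about the Navier–Stokes or Euler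
evolution (no function spaces, no uniqueness). It records, as a closed form on `ℝ³` (coordinates `x y z : ℝ`, `2π`-periodic in each),
the third classical lattice datum of the cell's atlas (family `CL-abc`; the cell uses `A = B = C = 1`),

  `u = A sin z + C cos y`, `v = B sin x + A cos z`, `w = C sin y + B cos x`
  [cite: Frisch1995Turbulence, eq. (9.4)] (the ABC flows of [cite: DombreEtAl1986, §1]),

and proves the exact POINTWISE identities on which the cell's reading of its `CL-abc` rows as an
"exact-solution precision probe" rests (HOME/LITERATURE.md §C10, REFEREE R177):

* `ABCFlow.div_eq_zero` — `∂ₓu + ∂_y v + ∂_z w = 0`;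
* `ABCFlow.curl_x_eq_u`, `curl_y_eq_v`, `curl_z_eq_w` — `∇ × (u,v,w) = (u,v,w)`: the datum is a
  Beltrami field with eigenvalue `+1` (the "Beltrami property" `V × (∇ × V) = 0` of
  [cite: DidovUleysky2018, §1], here in the sharper eigen-form; a direct computation);
* `ABCFlow.laplacian_u`, `laplacian_v`, `laplacian_w` — `Δuᵢ = -uᵢ` (all energy on the shell
  `|k|² = 1`);
* `ABCFlow.advection_x`, `advection_y`, `advection_z` — `((u,v,w)·∇)(u,v,w) = ∇(|(u,v,w)|²/2)`
  componentwise (the Lamb-vector/Bernoulli form of the nonlinearity for a Beltrami field). Together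
  with `Δuᵢ = -uᵢ` these are exactly the identities behind the printed statements "very simple
  steady flow, which is a solution of the Euler equation" [cite: Frisch1995Turbulence, text before
  eq. (9.4)] (pressure `-|u|²/2`) and "the ABC-flow can be considered as a solution of the
  Navier-Stokes equations" [cite: DidovUleysky2018, §1] (`e^{-νt}(u,v,w)` with pressure
  `-e^{-2νt}|u|²/2`). The last section makes the second statement a THEOREM in the same pointwise
  style: `ABCFlow.navierStokes_x/y/z` (the three momentum equations for `U,V,W = e^{-νt}(u,v,w)` and
  `P = -(e^{-νt})²|u|²/2`, every derivative explicit, any `ν`; `ν = 0` is steady Euler),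
  `ABCFlow.div_UVW_eq_zero`, and `ABCFlow.kinetic_UVW` (energy density `= (e^{-νt})²·|u|²/2`).
  Function spaces, periodicity and uniqueness are NOT addressed.

Design (as in `ClassicalLatticeData`): partial derivatives along coordinate lines with the
one-variable `deriv`; everything is `HasDerivAt` calculus for `sin`/`cos` plus `ring`. The three
amplitudes are bundled in `ABCFlow.Coeffs`; the cell's datum is `ABCFlow.Coeffs.cell = ⟨1, 1, 1⟩`.
(v3) CELL AVERAGES, in the iterated-interval-integral packaging of `ClassicalLatticeData`
(`cellEnergy`, `cellEnstrophy`, `cellHelicity`, `vorticity₁,₂,₃`): `ABCFlow.vorticity₁/₂/₃_eq`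
(`ω = u`), `ABCFlow.cellEnergy_eq` **`E(0) = (A² + B² + C²)/2`** (`cellEnergy_cell`: `3/2` for
`A = B = C = 1`, the starting value of the cell's `CL-abc` precision probe, HOME/LITERATURE.md
§C10), `ABCFlow.cellEnstrophy_eq` **`Z(0) = E(0)`**, `ABCFlow.cellHelicity_eq`
**`H(0) = A² + B² + C² = 2 E(0)`** (maximal helicity: the helicity density is `|u|²`).
What is deliberately NOT here: torus packaging, stagnation points / chaotic streamlines
[cite: DombreEtAl1986], and any evolution statement beyond the pointwise identities above.
-/

noncomputable section

namespace Literature.Analysis.FluidPDE.FluidComputer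

open Real

namespace ABCFlow

/-- The three amplitudes `A, B, C` of an ABC flow. [cite: Frisch1995Turbulence, eq. (9.4)] -/
structure Coeffs where
  /-- amplitude `A` -/
  A : ℝ
  /-- amplitude `B` -/
  B : ℝ
  /-- amplitude `C` -/
  C : ℝ

/-- The cell's `CL-abc` datum: `A = B = C = 1`. [folklore] -/
def Coeffs.cell : Coeffs := ⟨1, 1, 1⟩

variable (p : Coeffs)

/-- First component `u(x,y,z) = A sin z + C cos y` (independent of `x`).
[cite: Frisch1995Turbulence, eq. (9.4)] -/
def u (_x y z : ℝ) : ℝ := p.A * sin z + p.C * cos y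

/-- Second component `v(x,y,z) = B sin x + A cos z` (independent of `y`).
[cite: Frisch1995Turbulence, eq. (9.4)] -/
def v (x _y z : ℝ) : ℝ := p.B * sin x + p.A * cos z

/-- Third component `w(x,y,z) = C sin y + B cos x` (independent of `z`).
[cite: Frisch1995Turbulence, eq. (9.4)] -/
def w (x y _z : ℝ) : ℝ := p.C * sin y + p.B * cos x

/-- `u` closed form. [cite: Frisch1995Turbulence, eq. (9.4)] -/
theorem u_eq (x y z : ℝ) : u p x y z = p.A * sin z + p.C * cos y := rfl

/-- `v` closed form. [cite: Frisch1995Turbulence, eq. (9.4)] -/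
theorem v_eq (x y z : ℝ) : v p x y z = p.B * sin x + p.A * cos z := rfl

/-- `w` closed form. [cite: Frisch1995Turbulence, eq. (9.4)] -/
theorem w_eq (x y z : ℝ) : w p x y z = p.C * sin y + p.B * cos x := rfl

/-- The cell's datum, first component: `sin z + cos y`. [folklore] -/
theorem u_cell (x y z : ℝ) : u Coeffs.cell x y z = sin z + cos y := by
  simp [u_eq, Coeffs.cell]

/-- The cell's datum, second component: `sin x + cos z`. [folklore] -/
theorem v_cell (x y z : ℝ) : v Coeffs.cell x y z = sin x + cos z := by
  simp [v_eq, Coeffs.cell]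

/-- The cell's datum, third component: `sin y + cos x`. [folklore] -/
theorem w_cell (x y z : ℝ) : w Coeffs.cell x y z = sin y + cos x := by
  simp [w_eq, Coeffs.cell]

/-! ### First partial derivatives -/

/-- `∂ₓ u = 0`. [folklore] -/
theorem hasDerivAt_u_x (x y z : ℝ) : HasDerivAt (fun s => u p s y z) 0 x :=
  hasDerivAt_const x (p.A * sin z + p.C * cos y)

/-- `∂_y u = -C sin y`. [folklore] -/
theorem hasDerivAt_u_y (x y z : ℝ) : HasDerivAt (fun s => u p x s z) (-(p.C * sin y)) y :=
  ((hasDerivAt_const y (p.A * sin z)).add ((hasDerivAt_cos y).const_mul p.C)).congr_deriv (by ring)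

/-- `∂_z u = A cos z`. [folklore] -/
theorem hasDerivAt_u_z (x y z : ℝ) : HasDerivAt (fun s => u p x y s) (p.A * cos z) z :=
  (((hasDerivAt_sin z).const_mul p.A).add (hasDerivAt_const z (p.C * cos y))).congr_deriv (by ring)

/-- `∂ₓ v = B cos x`. [folklore] -/
theorem hasDerivAt_v_x (x y z : ℝ) : HasDerivAt (fun s => v p s y z) (p.B * cos x) x :=
  (((hasDerivAt_sin x).const_mul p.B).add (hasDerivAt_const x (p.A * cos z))).congr_deriv (by ring)

/-- `∂_y v = 0`. [folklore] -/
theorem hasDerivAt_v_y (x y z : ℝ) : HasDerivAt (fun s => v p x s z) 0 y :=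
  hasDerivAt_const y (p.B * sin x + p.A * cos z)

/-- `∂_z v = -A sin z`. [folklore] -/
theorem hasDerivAt_v_z (x y z : ℝ) : HasDerivAt (fun s => v p x y s) (-(p.A * sin z)) z :=
  ((hasDerivAt_const z (p.B * sin x)).add ((hasDerivAt_cos z).const_mul p.A)).congr_deriv (by ring)

/-- `∂ₓ w = -B sin x`. [folklore] -/
theorem hasDerivAt_w_x (x y z : ℝ) : HasDerivAt (fun s => w p s y z) (-(p.B * sin x)) x :=
  ((hasDerivAt_const x (p.C * sin y)).add ((hasDerivAt_cos x).const_mul p.B)).congr_deriv (by ring)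

/-- `∂_y w = C cos y`. [folklore] -/
theorem hasDerivAt_w_y (x y z : ℝ) : HasDerivAt (fun s => w p x s z) (p.C * cos y) y :=
  (((hasDerivAt_sin y).const_mul p.C).add (hasDerivAt_const y (p.B * cos x))).congr_deriv (by ring)

/-- `∂_z w = 0`. [folklore] -/
theorem hasDerivAt_w_z (x y z : ℝ) : HasDerivAt (fun s => w p x y s) 0 z :=
  hasDerivAt_const z (p.C * sin y + p.B * cos x)

/-! ### Divergence and curl -/

/-- The ABC datum is divergence-free: `∂ₓu + ∂_y v + ∂_z w = 0` (each term vanishes separately).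
[cite: Frisch1995Turbulence, eq. (9.4)] -/
theorem div_eq_zero (x y z : ℝ) :
    deriv (fun s => u p s y z) x + deriv (fun s => v p x s z) y + deriv (fun s => w p x y s) z = 0 := by
  rw [(hasDerivAt_u_x p x y z).deriv, (hasDerivAt_v_y p x y z).deriv, (hasDerivAt_w_z p x y z).deriv]
  ring

/-- Beltrami, first component: `(∇ × (u,v,w))ₓ = ∂_y w - ∂_z v = u`. [cite: DidovUleysky2018, §1] -/
theorem curl_x_eq_u (x y z : ℝ) :
    deriv (fun s => w p x s z) y - deriv (fun s => v p x y s) z = u p x y z := by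
  rw [(hasDerivAt_w_y p x y z).deriv, (hasDerivAt_v_z p x y z).deriv, u_eq]
  ring

/-- Beltrami, second component: `(∇ × (u,v,w))_y = ∂_z u - ∂ₓ w = v`. [cite: DidovUleysky2018, §1] -/
theorem curl_y_eq_v (x y z : ℝ) :
    deriv (fun s => u p x y s) z - deriv (fun s => w p s y z) x = v p x y z := by
  rw [(hasDerivAt_u_z p x y z).deriv, (hasDerivAt_w_x p x y z).deriv, v_eq]
  ring

/-- Beltrami, third component: `(∇ × (u,v,w))_z = ∂ₓ v - ∂_y u = w`. [cite: DidovUleysky2018, §1] -/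
theorem curl_z_eq_w (x y z : ℝ) :
    deriv (fun s => v p s y z) x - deriv (fun s => u p x s z) y = w p x y z := by
  rw [(hasDerivAt_v_x p x y z).deriv, (hasDerivAt_u_y p x y z).deriv, w_eq]
  ring

/-! ### Second derivatives and the Laplacian (`Δuᵢ = -uᵢ`) -/

/-- `∂ₓ² u = 0`. [folklore] -/
theorem deriv2_u_x (x y z : ℝ) : deriv (fun s => deriv (fun r => u p r y z) s) x = 0 := by
  have hfun : (fun s => deriv (fun r => u p r y z) s) = fun _ => (0 : ℝ) :=
    funext fun s => (hasDerivAt_u_x p s y z).deriv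
  rw [hfun, deriv_const]

/-- `∂_y² u = -C cos y`. [folklore] -/
theorem deriv2_u_y (x y z : ℝ) :
    deriv (fun s => deriv (fun r => u p x r z) s) y = -(p.C * cos y) := by
  have hfun : (fun s => deriv (fun r => u p x r z) s) = fun s => -(p.C * sin s) :=
    funext fun s => (hasDerivAt_u_y p x s z).deriv
  rw [hfun]
  exact ((hasDerivAt_sin y).const_mul p.C).neg.deriv

/-- `∂_z² u = -A sin z`. [folklore] -/
theorem deriv2_u_z (x y z : ℝ) :
    deriv (fun s => deriv (fun r => u p x y r) s) z = -(p.A * sin z) := by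
  have hfun : (fun s => deriv (fun r => u p x y r) s) = fun s => p.A * cos s :=
    funext fun s => (hasDerivAt_u_z p x y s).deriv
  rw [hfun]
  have h := (hasDerivAt_cos z).const_mul p.A
  rw [h.deriv]; ring

/-- `Δu = -u`: the first component is a Laplace eigenfunction with eigenvalue `-1`. [folklore] -/
theorem laplacian_u (x y z : ℝ) :
    deriv (fun s => deriv (fun r => u p r y z) s) x + deriv (fun s => deriv (fun r => u p x r z) s) y +
      deriv (fun s => deriv (fun r => u p x y r) s) z = -u p x y z := by
  rw [deriv2_u_x, deriv2_u_y, deriv2_u_z, u_eq]; ring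

/-- `∂ₓ² v = -B sin x`. [folklore] -/
theorem deriv2_v_x (x y z : ℝ) :
    deriv (fun s => deriv (fun r => v p r y z) s) x = -(p.B * sin x) := by
  have hfun : (fun s => deriv (fun r => v p r y z) s) = fun s => p.B * cos s :=
    funext fun s => (hasDerivAt_v_x p s y z).deriv
  rw [hfun]
  have h := (hasDerivAt_cos x).const_mul p.B
  rw [h.deriv]; ring

/-- `∂_y² v = 0`. [folklore] -/
theorem deriv2_v_y (x y z : ℝ) : deriv (fun s => deriv (fun r => v p x r z) s) y = 0 := by
  have hfun : (fun s => deriv (fun r => v p x r z) s) = fun _ => (0 : ℝ) :=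
    funext fun s => (hasDerivAt_v_y p x s z).deriv
  rw [hfun, deriv_const]

/-- `∂_z² v = -A cos z`. [folklore] -/
theorem deriv2_v_z (x y z : ℝ) :
    deriv (fun s => deriv (fun r => v p x y r) s) z = -(p.A * cos z) := by
  have hfun : (fun s => deriv (fun r => v p x y r) s) = fun s => -(p.A * sin s) :=
    funext fun s => (hasDerivAt_v_z p x y s).deriv
  rw [hfun]
  exact ((hasDerivAt_sin z).const_mul p.A).neg.deriv

/-- `Δv = -v`. [folklore] -/
theorem laplacian_v (x y z : ℝ) :
    deriv (fun s => deriv (fun r => v p r y z) s) x + deriv (fun s => deriv (fun r => v p x r z) s) y +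
      deriv (fun s => deriv (fun r => v p x y r) s) z = -v p x y z := by
  rw [deriv2_v_x, deriv2_v_y, deriv2_v_z, v_eq]; ring

/-- `∂ₓ² w = -B cos x`. [folklore] -/
theorem deriv2_w_x (x y z : ℝ) :
    deriv (fun s => deriv (fun r => w p r y z) s) x = -(p.B * cos x) := by
  have hfun : (fun s => deriv (fun r => w p r y z) s) = fun s => -(p.B * sin s) :=
    funext fun s => (hasDerivAt_w_x p s y z).deriv
  rw [hfun]
  exact ((hasDerivAt_sin x).const_mul p.B).neg.deriv

/-- `∂_y² w = -C sin y`. [folklore] -/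
theorem deriv2_w_y (x y z : ℝ) :
    deriv (fun s => deriv (fun r => w p x r z) s) y = -(p.C * sin y) := by
  have hfun : (fun s => deriv (fun r => w p x r z) s) = fun s => p.C * cos s :=
    funext fun s => (hasDerivAt_w_y p x s z).deriv
  rw [hfun]
  have h := (hasDerivAt_cos y).const_mul p.C
  rw [h.deriv]; ring

/-- `∂_z² w = 0`. [folklore] -/
theorem deriv2_w_z (x y z : ℝ) : deriv (fun s => deriv (fun r => w p x y r) s) z = 0 := by
  have hfun : (fun s => deriv (fun r => w p x y r) s) = fun _ => (0 : ℝ) :=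
    funext fun s => (hasDerivAt_w_z p x y s).deriv
  rw [hfun, deriv_const]

/-- `Δw = -w`. [folklore] -/
theorem laplacian_w (x y z : ℝ) :
    deriv (fun s => deriv (fun r => w p r y z) s) x + deriv (fun s => deriv (fun r => w p x r z) s) y +
      deriv (fun s => deriv (fun r => w p x y r) s) z = -w p x y z := by
  rw [deriv2_w_x, deriv2_w_y, deriv2_w_z, w_eq]; ring

/-! ### The advection term is a gradient: `((u,v,w)·∇)(u,v,w) = ∇(|(u,v,w)|²/2)` -/

/-- Kinetic-energy density `(u² + v² + w²)/2` of the datum. [folklore] -/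
def kinetic (x y z : ℝ) : ℝ :=
  (u p x y z * u p x y z + v p x y z * v p x y z + w p x y z * w p x y z) / 2

/-- `∂ₓ (|u|²/2) = u ∂ₓu + v ∂ₓv + w ∂ₓw` with the ABC values substituted. [folklore] -/
theorem hasDerivAt_kinetic_x (x y z : ℝ) :
    HasDerivAt (fun s => kinetic p s y z)
      (v p x y z * (p.B * cos x) + w p x y z * (-(p.B * sin x))) x := by
  have hu := hasDerivAt_u_x p x y z
  have hv := hasDerivAt_v_x p x y z
  have hw := hasDerivAt_w_x p x y z
  exact ((((hu.mul hu).add (hv.mul hv)).add (hw.mul hw)).div_const 2).congr_deriv (by ring)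

/-- `∂_y (|u|²/2) = u ∂_y u + v ∂_y v + w ∂_y w` with the ABC values substituted. [folklore] -/
theorem hasDerivAt_kinetic_y (x y z : ℝ) :
    HasDerivAt (fun s => kinetic p x s z)
      (u p x y z * (-(p.C * sin y)) + w p x y z * (p.C * cos y)) y := by
  have hu := hasDerivAt_u_y p x y z
  have hv := hasDerivAt_v_y p x y z
  have hw := hasDerivAt_w_y p x y z
  exact ((((hu.mul hu).add (hv.mul hv)).add (hw.mul hw)).div_const 2).congr_deriv (by ring)

/-- `∂_z (|u|²/2) = u ∂_z u + v ∂_z v + w ∂_z w` with the ABC values substituted. [folklore] -/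
theorem hasDerivAt_kinetic_z (x y z : ℝ) :
    HasDerivAt (fun s => kinetic p x y s)
      (u p x y z * (p.A * cos z) + v p x y z * (-(p.A * sin z))) z := by
  have hu := hasDerivAt_u_z p x y z
  have hv := hasDerivAt_v_z p x y z
  have hw := hasDerivAt_w_z p x y z
  exact ((((hu.mul hu).add (hv.mul hv)).add (hw.mul hw)).div_const 2).congr_deriv (by ring)

/-- Bernoulli form, first component: `u ∂ₓu + v ∂_y u + w ∂_z u = ∂ₓ(|u|²/2)` — for this Beltrami
field the Lamb vector `(∇ × u) × u` vanishes, so the advection term is a pure gradient.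
[cite: DidovUleysky2018, §1] -/
theorem advection_x (x y z : ℝ) :
    u p x y z * deriv (fun s => u p s y z) x + v p x y z * deriv (fun s => u p x s z) y +
      w p x y z * deriv (fun s => u p x y s) z = deriv (fun s => kinetic p s y z) x := by
  rw [(hasDerivAt_u_x p x y z).deriv, (hasDerivAt_u_y p x y z).deriv, (hasDerivAt_u_z p x y z).deriv,
    (hasDerivAt_kinetic_x p x y z).deriv, u_eq, v_eq, w_eq]
  ring

/-- Bernoulli form, second component: `u ∂ₓv + v ∂_y v + w ∂_z v = ∂_y(|u|²/2)`.
[cite: DidovUleysky2018, §1] -/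
theorem advection_y (x y z : ℝ) :
    u p x y z * deriv (fun s => v p s y z) x + v p x y z * deriv (fun s => v p x s z) y +
      w p x y z * deriv (fun s => v p x y s) z = deriv (fun s => kinetic p x s z) y := by
  rw [(hasDerivAt_v_x p x y z).deriv, (hasDerivAt_v_y p x y z).deriv, (hasDerivAt_v_z p x y z).deriv,
    (hasDerivAt_kinetic_y p x y z).deriv, u_eq, v_eq, w_eq]
  ring

/-- Bernoulli form, third component: `u ∂ₓw + v ∂_y w + w ∂_z w = ∂_z(|u|²/2)`.
[cite: DidovUleysky2018, §1] -/
theorem advection_z (x y z : ℝ) :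
    u p x y z * deriv (fun s => w p s y z) x + v p x y z * deriv (fun s => w p x s z) y +
      w p x y z * deriv (fun s => w p x y s) z = deriv (fun s => kinetic p x y s) z := by
  rw [(hasDerivAt_w_x p x y z).deriv, (hasDerivAt_w_y p x y z).deriv, (hasDerivAt_w_z p x y z).deriv,
    (hasDerivAt_kinetic_z p x y z).deriv, u_eq, v_eq, w_eq]
  ring

/-! ### The exact viscous decay: `e^{-νt}(u,v,w)` with pressure `-e^{-2νt}|(u,v,w)|²/2` solves the
Navier–Stokes momentum equations POINTWISE (classical form on `ℝ³`, every derivative explicit)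

This upgrades the remark in the module docstring to a theorem in the same coordinate-line style: with
`U = e^{-νt}u`, `V = e^{-νt}v`, `W = e^{-νt}w` and `P = -(e^{-νt})²·(u²+v²+w²)/2`,
`∂ₜU + U∂ₓU + V∂_yU + W∂_zU = -∂ₓP + ν(∂ₓ²U + ∂_y²U + ∂_z²U)` and the two companion equations hold at
every `(t,x,y,z)`, and `∂ₓU + ∂_yV + ∂_zW = 0` ("the ABC-flow can be considered as a solution of the
Navier-Stokes equations" [cite: DidovUleysky2018, §1]; `ν = 0` is the steady Euler statement of
[cite: Frisch1995Turbulence, text before eq. (9.4)]). Consequence used by the cell (HOME/LITERATURE.md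
§C10, REFEREE R177): every quadratic functional of the velocity decays exactly like `e^{-2νt}` — the
`CL-abc` rows are an exact-solution precision probe. (Function spaces, periodicity and uniqueness are
NOT addressed here.) -/

/-- The decaying ABC field, first component `U(t,x,y,z) = e^{-νt} u(x,y,z)`. [cite: DidovUleysky2018, §1] -/
def U (ν t x y z : ℝ) : ℝ := Real.exp (-(ν * t)) * u p x y z

/-- Second component `V = e^{-νt} v`. [cite: DidovUleysky2018, §1] -/
def V (ν t x y z : ℝ) : ℝ := Real.exp (-(ν * t)) * v p x y z

/-- Third component `W = e^{-νt} w`. [cite: DidovUleysky2018, §1] -/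
def W (ν t x y z : ℝ) : ℝ := Real.exp (-(ν * t)) * w p x y z

/-- The pressure `P = -(e^{-νt})² (u²+v²+w²)/2 = -e^{-2νt}|(u,v,w)|²/2` (Bernoulli pressure of a
Beltrami flow, decaying). [folklore] -/
def P (ν t x y z : ℝ) : ℝ := -(Real.exp (-(ν * t)) * Real.exp (-(ν * t)) * kinetic p x y z)

/-- `P = -e^{-2νt}·(u²+v²+w²)/2`, the printed form of the pressure. [folklore] -/
theorem P_eq (ν t x y z : ℝ) : P p ν t x y z = -(Real.exp (-(2 * ν * t)) * kinetic p x y z) := by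
  unfold P
  rw [← Real.exp_add]
  congr 3
  ring

/-- `∂ₜ U = -ν U`. [folklore] -/
theorem hasDerivAt_U_t (ν t x y z : ℝ) :
    HasDerivAt (fun s => U p ν s x y z) (-(ν * (Real.exp (-(ν * t)) * u p x y z))) t := by
  have h1 : HasDerivAt (fun s : ℝ => -(ν * s)) (-ν) t := by
    have hf : (fun s : ℝ => -(ν * s)) = fun s => -ν * id s := by
      funext s; simp only [id]; ring
    rw [hf]
    exact ((hasDerivAt_id t).const_mul (-ν)).congr_deriv (by ring)
  exact ((h1.exp).mul_const (u p x y z)).congr_deriv (by ring)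

/-- `∂ₜ V = -ν V`. [folklore] -/
theorem hasDerivAt_V_t (ν t x y z : ℝ) :
    HasDerivAt (fun s => V p ν s x y z) (-(ν * (Real.exp (-(ν * t)) * v p x y z))) t := by
  have h1 : HasDerivAt (fun s : ℝ => -(ν * s)) (-ν) t := by
    have hf : (fun s : ℝ => -(ν * s)) = fun s => -ν * id s := by
      funext s; simp only [id]; ring
    rw [hf]
    exact ((hasDerivAt_id t).const_mul (-ν)).congr_deriv (by ring)
  exact ((h1.exp).mul_const (v p x y z)).congr_deriv (by ring)

/-- `∂ₜ W = -ν W`. [folklore] -/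
theorem hasDerivAt_W_t (ν t x y z : ℝ) :
    HasDerivAt (fun s => W p ν s x y z) (-(ν * (Real.exp (-(ν * t)) * w p x y z))) t := by
  have h1 : HasDerivAt (fun s : ℝ => -(ν * s)) (-ν) t := by
    have hf : (fun s : ℝ => -(ν * s)) = fun s => -ν * id s := by
      funext s; simp only [id]; ring
    rw [hf]
    exact ((hasDerivAt_id t).const_mul (-ν)).congr_deriv (by ring)
  exact ((h1.exp).mul_const (w p x y z)).congr_deriv (by ring)

/-- Spatial first derivatives of `U`: `∂ₓU = 0`, `∂_yU = -e^{-νt} C sin y`, `∂_zU = e^{-νt} A cos z`.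
[folklore] -/
theorem deriv_U_space (ν t x y z : ℝ) :
    deriv (fun s => U p ν t s y z) x = 0 ∧
    deriv (fun s => U p ν t x s z) y = Real.exp (-(ν * t)) * (-(p.C * sin y)) ∧
    deriv (fun s => U p ν t x y s) z = Real.exp (-(ν * t)) * (p.A * cos z) := by
  refine ⟨?_, ?_, ?_⟩
  · have h := (hasDerivAt_u_x p x y z).const_mul (Real.exp (-(ν * t)))
    exact h.deriv.trans (by ring)
  · exact ((hasDerivAt_u_y p x y z).const_mul (Real.exp (-(ν * t)))).deriv
  · exact ((hasDerivAt_u_z p x y z).const_mul (Real.exp (-(ν * t)))).deriv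

/-- Spatial first derivatives of `V`: `∂ₓV = e^{-νt} B cos x`, `∂_yV = 0`, `∂_zV = -e^{-νt} A sin z`.
[folklore] -/
theorem deriv_V_space (ν t x y z : ℝ) :
    deriv (fun s => V p ν t s y z) x = Real.exp (-(ν * t)) * (p.B * cos x) ∧
    deriv (fun s => V p ν t x s z) y = 0 ∧
    deriv (fun s => V p ν t x y s) z = Real.exp (-(ν * t)) * (-(p.A * sin z)) := by
  refine ⟨?_, ?_, ?_⟩
  · exact ((hasDerivAt_v_x p x y z).const_mul (Real.exp (-(ν * t)))).deriv
  · have h := (hasDerivAt_v_y p x y z).const_mul (Real.exp (-(ν * t)))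
    exact h.deriv.trans (by ring)
  · exact ((hasDerivAt_v_z p x y z).const_mul (Real.exp (-(ν * t)))).deriv

/-- Spatial first derivatives of `W`: `∂ₓW = -e^{-νt} B sin x`, `∂_yW = e^{-νt} C cos y`, `∂_zW = 0`.
[folklore] -/
theorem deriv_W_space (ν t x y z : ℝ) :
    deriv (fun s => W p ν t s y z) x = Real.exp (-(ν * t)) * (-(p.B * sin x)) ∧
    deriv (fun s => W p ν t x s z) y = Real.exp (-(ν * t)) * (p.C * cos y) ∧
    deriv (fun s => W p ν t x y s) z = 0 := by
  refine ⟨?_, ?_, ?_⟩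
  · exact ((hasDerivAt_w_x p x y z).const_mul (Real.exp (-(ν * t)))).deriv
  · exact ((hasDerivAt_w_y p x y z).const_mul (Real.exp (-(ν * t)))).deriv
  · have h := (hasDerivAt_w_z p x y z).const_mul (Real.exp (-(ν * t)))
    exact h.deriv.trans (by ring)

/-- The decaying field stays divergence-free: `∂ₓU + ∂_yV + ∂_zW = 0`. [folklore] -/
theorem div_UVW_eq_zero (ν t x y z : ℝ) :
    deriv (fun s => U p ν t s y z) x + deriv (fun s => V p ν t x s z) y +
      deriv (fun s => W p ν t x y s) z = 0 := by
  rw [(deriv_U_space p ν t x y z).1, (deriv_V_space p ν t x y z).2.1, (deriv_W_space p ν t x y z).2.2]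
  ring

/-- `ΔU = -U` (each second derivative is `e^{-νt}` times that of `u`). [folklore] -/
theorem laplacian_U (ν t x y z : ℝ) :
    deriv (fun s => deriv (fun r => U p ν t r y z) s) x + deriv (fun s => deriv (fun r => U p ν t x r z) s) y +
      deriv (fun s => deriv (fun r => U p ν t x y r) s) z = -(Real.exp (-(ν * t)) * u p x y z) := by
  have ex : (fun s => deriv (fun r => U p ν t r y z) s) = fun s => Real.exp (-(ν * t)) * deriv (fun r => u p r y z) s :=
    funext fun s => by simp only [U]; exact deriv_const_mul_field (Real.exp (-(ν * t)))
  have ey : (fun s => deriv (fun r => U p ν t x r z) s) = fun s => Real.exp (-(ν * t)) * deriv (fun r => u p x r z) s :=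
    funext fun s => by simp only [U]; exact deriv_const_mul_field (Real.exp (-(ν * t)))
  have ez : (fun s => deriv (fun r => U p ν t x y r) s) = fun s => Real.exp (-(ν * t)) * deriv (fun r => u p x y r) s :=
    funext fun s => by simp only [U]; exact deriv_const_mul_field (Real.exp (-(ν * t)))
  rw [ex, ey, ez, deriv_const_mul_field (Real.exp (-(ν * t))), deriv_const_mul_field (Real.exp (-(ν * t))),
    deriv_const_mul_field (Real.exp (-(ν * t))),
    deriv2_u_x, deriv2_u_y, deriv2_u_z, u_eq]
  ring

/-- `ΔV = -V`. [folklore] -/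
theorem laplacian_V (ν t x y z : ℝ) :
    deriv (fun s => deriv (fun r => V p ν t r y z) s) x + deriv (fun s => deriv (fun r => V p ν t x r z) s) y +
      deriv (fun s => deriv (fun r => V p ν t x y r) s) z = -(Real.exp (-(ν * t)) * v p x y z) := by
  have ex : (fun s => deriv (fun r => V p ν t r y z) s) = fun s => Real.exp (-(ν * t)) * deriv (fun r => v p r y z) s :=
    funext fun s => by simp only [V]; exact deriv_const_mul_field (Real.exp (-(ν * t)))
  have ey : (fun s => deriv (fun r => V p ν t x r z) s) = fun s => Real.exp (-(ν * t)) * deriv (fun r => v p x r z) s :=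
    funext fun s => by simp only [V]; exact deriv_const_mul_field (Real.exp (-(ν * t)))
  have ez : (fun s => deriv (fun r => V p ν t x y r) s) = fun s => Real.exp (-(ν * t)) * deriv (fun r => v p x y r) s :=
    funext fun s => by simp only [V]; exact deriv_const_mul_field (Real.exp (-(ν * t)))
  rw [ex, ey, ez, deriv_const_mul_field (Real.exp (-(ν * t))), deriv_const_mul_field (Real.exp (-(ν * t))),
    deriv_const_mul_field (Real.exp (-(ν * t))),
    deriv2_v_x, deriv2_v_y, deriv2_v_z, v_eq]
  ring

/-- `ΔW = -W`. [folklore] -/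
theorem laplacian_W (ν t x y z : ℝ) :
    deriv (fun s => deriv (fun r => W p ν t r y z) s) x + deriv (fun s => deriv (fun r => W p ν t x r z) s) y +
      deriv (fun s => deriv (fun r => W p ν t x y r) s) z = -(Real.exp (-(ν * t)) * w p x y z) := by
  have ex : (fun s => deriv (fun r => W p ν t r y z) s) = fun s => Real.exp (-(ν * t)) * deriv (fun r => w p r y z) s :=
    funext fun s => by simp only [W]; exact deriv_const_mul_field (Real.exp (-(ν * t)))
  have ey : (fun s => deriv (fun r => W p ν t x r z) s) = fun s => Real.exp (-(ν * t)) * deriv (fun r => w p x r z) s :=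
    funext fun s => by simp only [W]; exact deriv_const_mul_field (Real.exp (-(ν * t)))
  have ez : (fun s => deriv (fun r => W p ν t x y r) s) = fun s => Real.exp (-(ν * t)) * deriv (fun r => w p x y r) s :=
    funext fun s => by simp only [W]; exact deriv_const_mul_field (Real.exp (-(ν * t)))
  rw [ex, ey, ez, deriv_const_mul_field (Real.exp (-(ν * t))), deriv_const_mul_field (Real.exp (-(ν * t))),
    deriv_const_mul_field (Real.exp (-(ν * t))),
    deriv2_w_x, deriv2_w_y, deriv2_w_z, w_eq]
  ring

/-- Pressure gradient, `x`: `∂ₓP = -(e^{-νt})² ∂ₓ(|u|²/2)`. [folklore] -/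
theorem deriv_P_x (ν t x y z : ℝ) :
    deriv (fun s => P p ν t s y z) x =
      -(Real.exp (-(ν * t)) * Real.exp (-(ν * t)) * (v p x y z * (p.B * cos x) + w p x y z * (-(p.B * sin x)))) := by
  exact (((hasDerivAt_kinetic_x p x y z).const_mul (Real.exp (-(ν * t)) * Real.exp (-(ν * t)))).neg).deriv

/-- Pressure gradient, `y`: `∂_yP = -(e^{-νt})² ∂_y(|u|²/2)`. [folklore] -/
theorem deriv_P_y (ν t x y z : ℝ) :
    deriv (fun s => P p ν t x s z) y =
      -(Real.exp (-(ν * t)) * Real.exp (-(ν * t)) * (u p x y z * (-(p.C * sin y)) + w p x y z * (p.C * cos y))) := by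
  exact (((hasDerivAt_kinetic_y p x y z).const_mul (Real.exp (-(ν * t)) * Real.exp (-(ν * t)))).neg).deriv

/-- Pressure gradient, `z`: `∂_zP = -(e^{-νt})² ∂_z(|u|²/2)`. [folklore] -/
theorem deriv_P_z (ν t x y z : ℝ) :
    deriv (fun s => P p ν t x y s) z =
      -(Real.exp (-(ν * t)) * Real.exp (-(ν * t)) * (u p x y z * (p.A * cos z) + v p x y z * (-(p.A * sin z)))) := by
  exact (((hasDerivAt_kinetic_z p x y z).const_mul (Real.exp (-(ν * t)) * Real.exp (-(ν * t)))).neg).deriv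

/-- **Navier–Stokes, first momentum equation, pointwise:**
`∂ₜU + U∂ₓU + V∂_yU + W∂_zU = -∂ₓP + ν(∂ₓ²U + ∂_y²U + ∂_z²U)` for the decaying ABC field and its
Bernoulli pressure, for every `ν` (ν = 0: steady Euler). [cite: DidovUleysky2018, §1] -/
theorem navierStokes_x (ν t x y z : ℝ) :
    deriv (fun s => U p ν s x y z) t +
        (U p ν t x y z * deriv (fun s => U p ν t s y z) x + V p ν t x y z * deriv (fun s => U p ν t x s z) y +
          W p ν t x y z * deriv (fun s => U p ν t x y s) z) =
      -deriv (fun s => P p ν t s y z) x +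
        ν * (deriv (fun s => deriv (fun r => U p ν t r y z) s) x +
          deriv (fun s => deriv (fun r => U p ν t x r z) s) y + deriv (fun s => deriv (fun r => U p ν t x y r) s) z) := by
  rw [(hasDerivAt_U_t p ν t x y z).deriv, (deriv_U_space p ν t x y z).1, (deriv_U_space p ν t x y z).2.1,
    (deriv_U_space p ν t x y z).2.2, deriv_P_x, laplacian_U]
  simp only [U, V, W, u_eq, v_eq, w_eq]
  ring

/-- **Navier–Stokes, second momentum equation, pointwise:**
`∂ₜV + U∂ₓV + V∂_yV + W∂_zV = -∂_yP + ν ΔV`. [cite: DidovUleysky2018, §1] -/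
theorem navierStokes_y (ν t x y z : ℝ) :
    deriv (fun s => V p ν s x y z) t +
        (U p ν t x y z * deriv (fun s => V p ν t s y z) x + V p ν t x y z * deriv (fun s => V p ν t x s z) y +
          W p ν t x y z * deriv (fun s => V p ν t x y s) z) =
      -deriv (fun s => P p ν t x s z) y +
        ν * (deriv (fun s => deriv (fun r => V p ν t r y z) s) x +
          deriv (fun s => deriv (fun r => V p ν t x r z) s) y + deriv (fun s => deriv (fun r => V p ν t x y r) s) z) := by
  rw [(hasDerivAt_V_t p ν t x y z).deriv, (deriv_V_space p ν t x y z).1, (deriv_V_space p ν t x y z).2.1,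
    (deriv_V_space p ν t x y z).2.2, deriv_P_y, laplacian_V]
  simp only [U, V, W, u_eq, v_eq, w_eq]
  ring

/-- **Navier–Stokes, third momentum equation, pointwise:**
`∂ₜW + U∂ₓW + V∂_yW + W∂_zW = -∂_zP + ν ΔW`. [cite: DidovUleysky2018, §1] -/
theorem navierStokes_z (ν t x y z : ℝ) :
    deriv (fun s => W p ν s x y z) t +
        (U p ν t x y z * deriv (fun s => W p ν t s y z) x + V p ν t x y z * deriv (fun s => W p ν t x s z) y +
          W p ν t x y z * deriv (fun s => W p ν t x y s) z) =
      -deriv (fun s => P p ν t x y s) z +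
        ν * (deriv (fun s => deriv (fun r => W p ν t r y z) s) x +
          deriv (fun s => deriv (fun r => W p ν t x r z) s) y + deriv (fun s => deriv (fun r => W p ν t x y r) s) z) := by
  rw [(hasDerivAt_W_t p ν t x y z).deriv, (deriv_W_space p ν t x y z).1, (deriv_W_space p ν t x y z).2.1,
    (deriv_W_space p ν t x y z).2.2, deriv_P_z, laplacian_W]
  simp only [U, V, W, u_eq, v_eq, w_eq]
  ring

/-- The energy density decays exactly like `e^{-2νt}`: `(U²+V²+W²)/2 = (e^{-νt})²·(u²+v²+w²)/2` — the
identity behind the cell's check `E(t) = E(0)e^{-2νt}` on its `CL-abc` rows. [folklore] -/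
theorem kinetic_UVW (ν t x y z : ℝ) :
    (U p ν t x y z * U p ν t x y z + V p ν t x y z * V p ν t x y z + W p ν t x y z * W p ν t x y z) / 2 =
      Real.exp (-(ν * t)) * Real.exp (-(ν * t)) * kinetic p x y z := by
  simp only [U, V, W, kinetic]
  ring

end ABCFlow

open intervalIntegral

/-! ## (v3) Cell averages of the ABC datum -/

namespace PeriodIntegral

/-- `∫₀^{2π} sin x dx = 0`. [folklore] -/
theorem integral_sin_two_pi : ∫ x in (0:ℝ)..2 * π, sin x = 0 := by
  rw [integral_sin]; simp

/-- `∫₀^{2π} cos x dx = 0`. [folklore] -/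
theorem integral_cos_two_pi : ∫ x in (0:ℝ)..2 * π, cos x = 0 := by
  rw [integral_cos]; simp

end PeriodIntegral

namespace ABCFlow

open PeriodIntegral

variable (p : Coeffs)

/-! ### Cell averages of the ABC datum: `E = Z = (A²+B²+C²)/2`, `H = A²+B²+C² = 2E` -/

/-- The vorticity of the ABC datum IS the datum (Beltrami), in the `vorticity₁` packaging of
`ClassicalLatticeData`. [cite: DidovUleysky2018, §1] -/
theorem vorticity₁_eq (x y z : ℝ) : vorticity₁ (u p) (v p) (w p) x y z = u p x y z :=
  curl_x_eq_u p x y z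

/-- Second component: `ω₂ = v`. [cite: DidovUleysky2018, §1] -/
theorem vorticity₂_eq (x y z : ℝ) : vorticity₂ (u p) (v p) (w p) x y z = v p x y z :=
  curl_y_eq_v p x y z

/-- Third component: `ω₃ = w`. [cite: DidovUleysky2018, §1] -/
theorem vorticity₃_eq (x y z : ℝ) : vorticity₃ (u p) (v p) (w p) x y z = w p x y z :=
  curl_z_eq_w p x y z

/-- Innermost (`z`) integral of `|u|²` for the ABC datum. [folklore] -/
theorem integral_z_speed_sq (x y : ℝ) :
    ∫ z in (0:ℝ)..2 * π, (u p x y z ^ 2 + v p x y z ^ 2 + w p x y z ^ 2) =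
      2 * π * p.A ^ 2 + 2 * π * (p.C ^ 2 * cos y ^ 2 + p.B ^ 2 * sin x ^ 2 +
        (p.C * sin y + p.B * cos x) ^ 2) := by
  have h : (fun z => u p x y z ^ 2 + v p x y z ^ 2 + w p x y z ^ 2) = fun z =>
      p.A ^ 2 * sin z ^ 2 + p.A ^ 2 * cos z ^ 2 + (2 * p.A * p.C * cos y) * sin z +
      (2 * p.A * p.B * sin x) * cos z +
      (p.C ^ 2 * cos y ^ 2 + p.B ^ 2 * sin x ^ 2 + (p.C * sin y + p.B * cos x) ^ 2) * 1 +
      0 * (1:ℝ) := by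
    funext z; rw [u_eq, v_eq, w_eq]; ring
  rw [h, integral_lin6 _ _ _ _ _ _ _ _ _ _ _ _ (by fun_prop) (by fun_prop) (by fun_prop)
    (by fun_prop) continuous_const continuous_const, integral_sin_sq_two_pi,
    integral_cos_sq_two_pi, integral_sin_two_pi, integral_cos_two_pi, integral_one_two_pi]
  ring

/-- The `y,z` integral of `|u|²`. [folklore] -/
theorem integral_yz_speed_sq (x : ℝ) :
    ∫ y in (0:ℝ)..2 * π, ∫ z in (0:ℝ)..2 * π, (u p x y z ^ 2 + v p x y z ^ 2 + w p x y z ^ 2) =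
      4 * π ^ 2 * (p.A ^ 2 + p.C ^ 2) + 4 * π ^ 2 * p.B ^ 2 * (sin x ^ 2 + cos x ^ 2) := by
  have h : (fun y => ∫ z in (0:ℝ)..2 * π, (u p x y z ^ 2 + v p x y z ^ 2 + w p x y z ^ 2)) =
      fun y => (2 * π * p.C ^ 2) * cos y ^ 2 + (2 * π * p.C ^ 2) * sin y ^ 2 +
        (4 * π * p.B * p.C * cos x) * sin y +
        (2 * π * p.A ^ 2 + 2 * π * p.B ^ 2 * (sin x ^ 2 + cos x ^ 2)) * 1 := by
    funext y; rw [integral_z_speed_sq]; ring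
  rw [h, integral_lin4 _ _ _ _ _ _ _ _ (by fun_prop) (by fun_prop) (by fun_prop) continuous_const,
    integral_cos_sq_two_pi, integral_sin_sq_two_pi, integral_sin_two_pi, integral_one_two_pi]
  ring

/-- `∫∫∫ |u|² = 8π³ (A² + B² + C²)` for the ABC datum. [folklore] -/
theorem cellIntegral_speed_sq :
    cellIntegral (fun x y z => u p x y z ^ 2 + v p x y z ^ 2 + w p x y z ^ 2) =
      8 * π ^ 3 * (p.A ^ 2 + p.B ^ 2 + p.C ^ 2) := by
  unfold cellIntegral
  have h : (fun x => ∫ y in (0:ℝ)..2 * π, ∫ z in (0:ℝ)..2 * π,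
      (u p x y z ^ 2 + v p x y z ^ 2 + w p x y z ^ 2)) =
      fun x => (4 * π ^ 2 * (p.A ^ 2 + p.C ^ 2)) * 1 + (4 * π ^ 2 * p.B ^ 2) * sin x ^ 2 +
        (4 * π ^ 2 * p.B ^ 2) * cos x ^ 2 := by
    funext x; rw [integral_yz_speed_sq]; ring
  rw [h, integral_lin3 _ _ _ _ _ _ continuous_const (by fun_prop) (by fun_prop),
    integral_one_two_pi, integral_sin_sq_two_pi, integral_cos_sq_two_pi]
  ring

/-- **`E(0) = (A² + B² + C²)/2` for the ABC datum** (`3/2` for the cell's `CL-abc` member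
`A = B = C = 1`; HOME/LITERATURE.md §C10: the exact-solution precision probe starts from
`E(0) = 1.5`). [folklore] -/
theorem cellEnergy_eq : cellEnergy (u p) (v p) (w p) = (p.A ^ 2 + p.B ^ 2 + p.C ^ 2) / 2 := by
  unfold cellEnergy
  rw [cellMean_eq, cellIntegral_speed_sq, div_div, div_eq_iff (by positivity)]
  ring

/-- `E(0) = 3/2` for the cell's member `A = B = C = 1`. [folklore] -/
theorem cellEnergy_cell : cellEnergy (u Coeffs.cell) (v Coeffs.cell) (w Coeffs.cell) = 3 / 2 := by
  rw [cellEnergy_eq]; simp [Coeffs.cell]; norm_num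

/-- **`Z(0) = E(0)`** for the ABC datum: the vorticity is the velocity (Beltrami, `|k| = 1`).
[folklore] -/
theorem cellEnstrophy_eq : cellEnstrophy (u p) (v p) (w p) = (p.A ^ 2 + p.B ^ 2 + p.C ^ 2) / 2 := by
  unfold cellEnstrophy
  have h1 : vorticity₁ (u p) (v p) (w p) = u p := by
    funext x y z; exact vorticity₁_eq p x y z
  have h2 : vorticity₂ (u p) (v p) (w p) = v p := by
    funext x y z; exact vorticity₂_eq p x y z
  have h3 : vorticity₃ (u p) (v p) (w p) = w p := by
    funext x y z; exact vorticity₃_eq p x y z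
  rw [h1, h2, h3, cellEnergy_eq]

/-- **`H(0) = A² + B² + C² = 2 E(0)`** for the ABC datum: the helicity density is `|u|²`
(maximal helicity — the Beltrami property the cell's `PK-coherent` `helical_wave` carrier and
the `CL-abc` slot are built on). [folklore] -/
theorem cellHelicity_eq : cellHelicity (u p) (v p) (w p) = p.A ^ 2 + p.B ^ 2 + p.C ^ 2 := by
  unfold cellHelicity
  simp_rw [vorticity₁_eq, vorticity₂_eq, vorticity₃_eq]
  rw [cellMean_eq]
  have h : (fun x y z => u p x y z * u p x y z + v p x y z * v p x y z + w p x y z * w p x y z) =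
      fun x y z => u p x y z ^ 2 + v p x y z ^ 2 + w p x y z ^ 2 := by
    funext x y z; ring
  rw [h, cellIntegral_speed_sq, div_eq_iff (by positivity)]
  ring

/-- `H(0) = 2 E(0)` for the ABC datum. [folklore] -/
theorem cellHelicity_eq_two_mul_cellEnergy :
    cellHelicity (u p) (v p) (w p) = 2 * cellEnergy (u p) (v p) (w p) := by
  rw [cellHelicity_eq, cellEnergy_eq]; ring

end ABCFlow

end Literature.Analysis.FluidPDE.FluidComputer

end
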